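import Summits.QuantumFields.YangMills.Theorems.BalabanLadderIRTwistedSlabRealSlice
import Summits.QuantumFields.YangMills.Theorems.BalabanLadderIRTwistedSlabExpChartTaylor
import Mathlib.Analysis.Calculus.FDeriv.Symmetric
import Mathlib.Analysis.InnerProductSpace.Dual
import HarnessLib

/-!
# One-point data of the twisted exponent on the real Coulomb slice through a frame `T_V : V ≃L realCoulombSlice U` (any classical vacuum `U`):
# the slice Hessian operator `A` (symmetric, POSITIVE DEFINITE), the second-order Peano expansion `F(y) − F(0) − ½⟪A y, y⟫ = o(‖y‖²)`, `F(0) = 0`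
# — the `hS2` ∕ `hA` ∕ `hpos` inputs of lit-4's L9 `tendsto_laplaceMethod_fibred_chart` ∕ L18 `tendsto_laplaceMethod_orbit`, as statements on `V`

HELPER toward stub **T1** `TwistedSlabAnchor` (LINE `twisted-slab-continuity`, crux `IRcof` stmt-QuantumFields-26930, census row 43;
LEAD prover ym-ir-line-tsc-p1 g3; `--supports` the crux, `--as helper`).  Sequel of K5 (`…ExpChartTaylor`: Taylor-2 of `chartAction`), K10 (`…ExpLine`),
K13 (`…RealSlice`: `hessian_pos_of_mem_realCoulombSlice_ne_zero`).  Scope `Matrix.Norms.Frobenius` (the K4∕K5 currency); every conclusion is a statement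
about the abstract inner-product model `V` only (norm of `V`, `⟪·,·⟫`), hence consumable from the `Matrix.Norms.L2Operator` files K16–K18.
* §1 `sliceDir T_V : V →L[ℝ] (Fin 4 → fields)` (frame followed by the inclusion), `sliceDir_mem`, `sliceDir_injective`; the SLICE PHASE
  `slicePhase k U T_V y = chartAction ↑U (slabTwistPhase k) (sliceDir T_V y)` (= `twistedExponent k (e^{T_V y}·U)`, `slicePhase_eq_twistedExponent_expLine`),
  `slicePhase_zero` (`= 0` at a vacuum), `slicePhase_nonneg`.
* §2 the SLICE HESSIAN OPERATOR `sliceHessian k U T_V : V →ₗ[ℝ] V` (Riesz vector of `y' ↦ D²chartAction(0)(S y, S y')`), `inner_sliceHessian`,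
  ★ `sliceHessian_isSymmetric` (Schwarz: `ContDiffAt.isSymmSndFDerivAt`), ★★ `sliceHessian_pos` (`0 < ⟪A y, y⟫` for `y ≠ 0` at a vacuum `U` with
  `twistedExponent k U = 0`, `k` a unit, `N(m+1) ≥ 2` — K13).
* §3 ★★ `isLittleO_slicePhase_taylor_two` : `(fun y => F y − F 0 − ½⟪A y, y⟫) =o[𝓝 0] fun y => ‖y‖²` at a vacuum (K5's Taylor-2 pulled back along
  `sliceDir`; the linear term vanishes because `t ↦ F(t y) = twistedExponent ≥ 0` has a minimum at `0`: `IsLocalMin.deriv_eq_zero`).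
NOT here (honest scope): the separation `hsep` on the slice window (needs the slice property ∕ local structure of the vacuum set), `hout` ∕ several
orbits, the L18∕L21 call; anything uniform in `β` (M3); the cluster expansion (M4); T1-box 0∕1, T1 proper 0∕1.

HONEST FRAMING: finite-dimensional calculus on one box; nothing here bears on `IRcof`, `IR`, or the Yang–Mills mass gap (Clay: NOT proved); R4 =
`BalabanLadder.UV` only.  References: K. W. Breitung, *Asymptotic Approximations for Probability Integrals* (1994) Thm 41 (second-order data at the
critical manifold); M. García Pérez, A. González-Arroyo, M. Okawa, JHEP 10 (2017) 150 §2.5; A. González-Arroyo (1998) §4.2.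
-/

set_option autoImplicit false

noncomputable section

open scoped Matrix Matrix.Norms.Frobenius Topology InnerProductSpace
open Filter NormedSpace Asymptotics
open Literature.MathematicalPhysics.QuantumFieldTheory Literature.MathematicalPhysics.QuantumLattice
open Literature.Analysis.OperatorTheory

namespace Summit.QuantumFields.YangMills.Cruxes.IRcof.TwistedSlab

variable {N : ℕ} {n₀ n₁ n₂ n₃ : ℕ}
variable {V : Type*} [NormedAddCommGroup V] [InnerProductSpace ℝ V]

/-! ## §1 The slice directions and the slice phase -/

section Phase

variable (U : FinTorusSite n₀ n₁ n₂ n₃ × Fin 4 → Matrix.specialUnitaryGroup (Fin N) ℂ)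
variable (T_V : V ≃L[ℝ] realCoulombSlice (fun e => ((U e : Matrix.specialUnitaryGroup (Fin N) ℂ) : Matrix (Fin N) (Fin N) ℂ)))

/-- **Slice directions**: the frame followed by the inclusion of the real Coulomb slice, `S = ι ∘ T_V : V →L (Fin 4 → fields)`. [folklore] -/
def sliceDir : V →L[ℝ] (Fin 4 → FinTorusSite n₀ n₁ n₂ n₃ → Matrix (Fin N) (Fin N) ℂ) :=
  ((realCoulombSlice (fun e => ((U e : Matrix.specialUnitaryGroup (Fin N) ℂ) : Matrix (Fin N) (Fin N) ℂ))).subtypeL).comp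
    (T_V : V →L[ℝ] realCoulombSlice (fun e => ((U e : Matrix.specialUnitaryGroup (Fin N) ℂ) : Matrix (Fin N) (Fin N) ℂ)))

/-- Unfolding lemma. [folklore] -/
theorem sliceDir_apply (y : V) :
    sliceDir U T_V y = ((T_V y : realCoulombSlice (fun e => ((U e : Matrix.specialUnitaryGroup (Fin N) ℂ) : Matrix (Fin N) (Fin N) ℂ))) :
      Fin 4 → FinTorusSite n₀ n₁ n₂ n₃ → Matrix (Fin N) (Fin N) ℂ) := rfl

/-- Slice directions lie in the real Coulomb slice. [folklore] -/
theorem sliceDir_mem (y : V) : sliceDir U T_V y ∈ realCoulombSlice (fun e => ((U e : Matrix.specialUnitaryGroup (Fin N) ℂ) : Matrix (Fin N) (Fin N) ℂ)) :=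
  (T_V y).2

/-- `S` is injective. [folklore] -/
theorem sliceDir_injective : Function.Injective (sliceDir U T_V) :=
  fun _ _ h => T_V.injective (Subtype.ext h)

/-- **The slice phase** `F(y) = chartAction ↑U (slabTwistPhase k) (S y)` — the twisted exponent of `e^{S y}·U` (K9 ∕ K10). [cite: GarciaperezGonzalezarroyoOkawa2017, §2.5] -/
def slicePhase (k : ZMod N) : V → ℝ :=
  fun y => chartAction (fun e => ((U e : Matrix.specialUnitaryGroup (Fin N) ℂ) : Matrix (Fin N) (Fin N) ℂ)) (slabTwistPhase k) (sliceDir U T_V y)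

/-- Along rays the slice phase is the twisted exponent of the exponential line: `F(t y) = twistedExponent k (expLine U (S y) t)`. [cite: Gonzalezarroyo1998, §4.2] -/
theorem slicePhase_smul_eq_twistedExponent_expLine (k : ZMod N) (y : V) (t : ℝ) :
    slicePhase U T_V k (t • y) = twistedExponent k (expLine U (skew_of_mem_realCoulombSlice (sliceDir_mem U T_V y))
      (trace_of_mem_realCoulombSlice (sliceDir_mem U T_V y)) t) := by
  rw [slicePhase, map_smul, chartAction_smul]
  exact (congrFun (twistedExponent_expLine_eq_lineAction k U _ _) t).symm

/-- `F(y) = twistedExponent k (expLine U (S y) 1)`. [cite: Gonzalezarroyo1998, §4.2] -/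
theorem slicePhase_eq_twistedExponent_expLine (k : ZMod N) (y : V) :
    slicePhase U T_V k y = twistedExponent k (expLine U (skew_of_mem_realCoulombSlice (sliceDir_mem U T_V y))
      (trace_of_mem_realCoulombSlice (sliceDir_mem U T_V y)) 1) := by
  rw [← slicePhase_smul_eq_twistedExponent_expLine, one_smul]

/-- The slice phase is non-negative. [folklore] -/
theorem slicePhase_nonneg (k : ZMod N) (y : V) : 0 ≤ slicePhase U T_V k y := by
  rw [slicePhase_eq_twistedExponent_expLine]; exact twistedExponent_nonneg k _

/-- At a vacuum the slice phase vanishes at `0`. [folklore] -/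
theorem slicePhase_zero (k : ZMod N) (hU : twistedExponent k U = 0) : slicePhase U T_V k 0 = 0 := by
  rw [← zero_smul ℝ (0 : V), slicePhase_smul_eq_twistedExponent_expLine, expLine_zero, hU]

/-- At a vacuum, `0` is a minimum of `t ↦ F(t y)`; hence the directional derivative vanishes: `deriv (lineAction ↑U (S y) c) 0 = 0`. [folklore] -/
theorem deriv_lineAction_sliceDir_zero (k : ZMod N) (hU : twistedExponent k U = 0) (y : V) :
    deriv (lineAction (fun e => ((U e : Matrix.specialUnitaryGroup (Fin N) ℂ) : Matrix (Fin N) (Fin N) ℂ)) (sliceDir U T_V y) (slabTwistPhase k)) 0 = 0 := by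
  apply IsLocalMin.deriv_eq_zero
  refine Filter.Eventually.of_forall fun t => ?_
  have h0 : lineAction (fun e => ((U e : Matrix.specialUnitaryGroup (Fin N) ℂ) : Matrix (Fin N) (Fin N) ℂ)) (sliceDir U T_V y) (slabTwistPhase k) 0 = 0 := by
    rw [← chartAction_smul, ← map_smul, zero_smul]; exact slicePhase_zero U T_V k hU
  have ht : 0 ≤ lineAction (fun e => ((U e : Matrix.specialUnitaryGroup (Fin N) ℂ) : Matrix (Fin N) (Fin N) ℂ)) (sliceDir U T_V y) (slabTwistPhase k) t := by
    rw [← chartAction_smul, ← map_smul]; exact slicePhase_nonneg U T_V k (t • y)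
  rw [h0]; exact ht

/-- At a vacuum the differential of `chartAction` at `0` kills the slice directions. [folklore] -/
theorem fderiv_chartAction_zero_sliceDir (k : ZMod N) (hU : twistedExponent k U = 0) (y : V) :
    fderiv ℝ (chartAction (fun e => ((U e : Matrix.specialUnitaryGroup (Fin N) ℂ) : Matrix (Fin N) (Fin N) ℂ)) (slabTwistPhase k)) 0 (sliceDir U T_V y) = 0 := by
  have h := ((differentiable_chartAction (fun e => ((U e : Matrix.specialUnitaryGroup (Fin N) ℂ) : Matrix (Fin N) (Fin N) ℂ)) (slabTwistPhase k)) 0).lineDeriv_eq_fderiv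
    (v := sliceDir U T_V y)
  calc fderiv ℝ (chartAction (fun e => ((U e : Matrix.specialUnitaryGroup (Fin N) ℂ) : Matrix (Fin N) (Fin N) ℂ)) (slabTwistPhase k)) 0 (sliceDir U T_V y)
        = lineDeriv ℝ (chartAction (fun e => ((U e : Matrix.specialUnitaryGroup (Fin N) ℂ) : Matrix (Fin N) (Fin N) ℂ)) (slabTwistPhase k)) 0 (sliceDir U T_V y) :=
          h.symm
    _ = deriv (lineAction (fun e => ((U e : Matrix.specialUnitaryGroup (Fin N) ℂ) : Matrix (Fin N) (Fin N) ℂ)) (sliceDir U T_V y) (slabTwistPhase k)) 0 :=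
          lineDeriv_chartAction_zero _ _ _
    _ = 0 := deriv_lineAction_sliceDir_zero U T_V k hU y

end Phase

/-! ## §2 The slice Hessian operator -/

section Hessian

variable [CompleteSpace V]
variable (U : FinTorusSite n₀ n₁ n₂ n₃ × Fin 4 → Matrix.specialUnitaryGroup (Fin N) ℂ)
variable (T_V : V ≃L[ℝ] realCoulombSlice (fun e => ((U e : Matrix.specialUnitaryGroup (Fin N) ℂ) : Matrix (Fin N) (Fin N) ℂ)))

/-- **The slice Hessian operator** `A : V →ₗ[ℝ] V`, the Riesz vector of the bilinear form `(y, y') ↦ D²chartAction_{↑U}(0)(S y, S y')`.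
[cite: Breitung1994, Thm 41 (the matrix of second derivatives at the critical point)] -/
def sliceHessian (k : ZMod N) : V →ₗ[ℝ] V where
  toFun y := (InnerProductSpace.toDual ℝ V).symm
    ((fderiv ℝ (fderiv ℝ (chartAction (fun e => ((U e : Matrix.specialUnitaryGroup (Fin N) ℂ) : Matrix (Fin N) (Fin N) ℂ)) (slabTwistPhase k))) 0
      (sliceDir U T_V y)).comp (sliceDir U T_V))
  map_add' y y' := by rw [map_add, map_add, ContinuousLinearMap.add_comp, map_add]
  map_smul' r y := by rw [map_smul, map_smul, ContinuousLinearMap.smul_comp, map_smul, RingHom.id_apply]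

/-- ★ `⟪A y, y'⟫ = D²chartAction(0)(S y, S y')`. [cite: Breitung1994, Thm 41] -/
theorem inner_sliceHessian (k : ZMod N) (y y' : V) :
    ⟪sliceHessian U T_V k y, y'⟫_ℝ =
      fderiv ℝ (fderiv ℝ (chartAction (fun e => ((U e : Matrix.specialUnitaryGroup (Fin N) ℂ) : Matrix (Fin N) (Fin N) ℂ)) (slabTwistPhase k))) 0
        (sliceDir U T_V y) (sliceDir U T_V y') := by
  rw [sliceHessian, LinearMap.coe_mk, AddHom.coe_mk, InnerProductSpace.toDual_symm_apply, ContinuousLinearMap.comp_apply]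

/-- ★ **The slice Hessian operator is symmetric** (Schwarz's theorem for the `C^∞` function `chartAction`). [folklore] -/
theorem sliceHessian_isSymmetric (k : ZMod N) : (sliceHessian U T_V k).IsSymmetric := by
  intro y y'
  have hsymm := ((contDiff_chartAction (fun e => ((U e : Matrix.specialUnitaryGroup (Fin N) ℂ) : Matrix (Fin N) (Fin N) ℂ)) (slabTwistPhase k)).contDiffAt
    (x := 0)).isSymmSndFDerivAt (n := ⊤) (by simp)
  rw [inner_sliceHessian, real_inner_comm, inner_sliceHessian]
  exact hsymm _ _

/-- On the diagonal: `⟪A y, y⟫ = d²/dt²|₀ twistedExponent k (expLine U (S y) t)` (K10). [cite: Gonzalezarroyo1998, §4.2] -/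
theorem inner_sliceHessian_self_eq_iteratedDeriv (k : ZMod N) (y : V) :
    ⟪sliceHessian U T_V k y, y⟫_ℝ = iteratedDeriv 2 (fun t => twistedExponent k (expLine U (skew_of_mem_realCoulombSlice (sliceDir_mem U T_V y))
      (trace_of_mem_realCoulombSlice (sliceDir_mem U T_V y)) t)) 0 := by
  rw [inner_sliceHessian, iteratedDeriv_two_twistedExponent_expLine_eq_hessian]

/-- ★★ **THE SLICE HESSIAN IS POSITIVE DEFINITE AT EVERY CLASSICAL VACUUM** (`k` a unit, box `(m+1)² × (m₂+1) × (m₃+1)`, `N(m+1) ≥ 2`,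
`twistedExponent k U = 0`): `0 < ⟪A y, y⟫` for `y ≠ 0` — K13's Coulomb-gauge Hessian gap read through the frame. This is the `hpos` input of lit-4's
L18 `tendsto_laplaceMethod_orbit`. [cite: GarciaperezGonzalezarroyoOkawa2017, §2.2, §2.5] [cite: Gonzalezarroyo1998, §4.2] -/
theorem sliceHessian_pos [NeZero N] {m m₂ m₃ : ℕ} {k : ZMod N} (hk : IsUnit k) (hNm : 2 ≤ N * (m + 1))
    (U : FinTorusSite (m + 1) (m + 1) (m₂ + 1) (m₃ + 1) × Fin 4 → Matrix.specialUnitaryGroup (Fin N) ℂ) (hU : twistedExponent k U = 0)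
    (T_V : V ≃L[ℝ] realCoulombSlice (fun e => ((U e : Matrix.specialUnitaryGroup (Fin N) ℂ) : Matrix (Fin N) (Fin N) ℂ)))
    {y : V} (hy : y ≠ 0) : 0 < ⟪sliceHessian U T_V k y, y⟫_ℝ := by
  rw [inner_sliceHessian_self_eq_iteratedDeriv]
  have hne : sliceDir U T_V y ≠ 0 := fun h => hy (sliceDir_injective U T_V (by rw [h, map_zero]))
  exact hessian_pos_of_mem_realCoulombSlice_ne_zero hk hNm U hU (sliceDir_mem U T_V y) hne

end Hessian

/-! ## §3 The second-order Peano expansion of the slice phase at a vacuum -/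

section Taylor

variable [CompleteSpace V]
variable (U : FinTorusSite n₀ n₁ n₂ n₃ × Fin 4 → Matrix.specialUnitaryGroup (Fin N) ℂ)
variable (T_V : V ≃L[ℝ] realCoulombSlice (fun e => ((U e : Matrix.specialUnitaryGroup (Fin N) ℂ) : Matrix (Fin N) (Fin N) ℂ)))

/-- ★★ **SECOND-ORDER PEANO EXPANSION OF THE SLICE PHASE AT A VACUUM**: `F(y) − F(0) − ½⟪A y, y⟫ = o(‖y‖²)` as `y → 0` in the model space `V`
(K5's Taylor-2 of `chartAction` pulled back along the continuous linear `S`; the linear term vanishes at the minimum).  This is the one-point `hS2`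
hypothesis of lit-4's L9 ∕ L18. [cite: Breitung1994, Thm 41 proof (second-order expansion at the critical point)] -/
theorem isLittleO_slicePhase_taylor_two (k : ZMod N) (hU : twistedExponent k U = 0) :
    (fun y => slicePhase U T_V k y - slicePhase U T_V k 0 - (1 / 2) * ⟪sliceHessian U T_V k y, y⟫_ℝ) =o[𝓝 0] fun y => ‖y‖ ^ 2 := by
  have hK5 := isLittleO_chartAction_taylor_two (fun e => ((U e : Matrix.specialUnitaryGroup (Fin N) ℂ) : Matrix (Fin N) (Fin N) ℂ)) (slabTwistPhase k)
    (0 : Fin 4 → FinTorusSite n₀ n₁ n₂ n₃ → Matrix (Fin N) (Fin N) ℂ)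
  have hS : Tendsto (sliceDir U T_V) (𝓝 0) (𝓝 0) := by
    have h := (sliceDir U T_V).continuous.tendsto 0
    rwa [map_zero] at h
  have h1 := hK5.comp_tendsto hS
  -- the pulled-back expansion, with the vanishing linear term and the Hessian read as `⟪A y, y⟫`
  have h2 : (fun y => slicePhase U T_V k y - slicePhase U T_V k 0 - (1 / 2) * ⟪sliceHessian U T_V k y, y⟫_ℝ) =
      (fun a => chartAction (fun e => ((U e : Matrix.specialUnitaryGroup (Fin N) ℂ) : Matrix (Fin N) (Fin N) ℂ)) (slabTwistPhase k) a -
        chartAction (fun e => ((U e : Matrix.specialUnitaryGroup (Fin N) ℂ) : Matrix (Fin N) (Fin N) ℂ)) (slabTwistPhase k) 0 -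
        fderiv ℝ (chartAction (fun e => ((U e : Matrix.specialUnitaryGroup (Fin N) ℂ) : Matrix (Fin N) (Fin N) ℂ)) (slabTwistPhase k)) 0 (a - 0) -
        (1 / 2) * fderiv ℝ (fderiv ℝ (chartAction (fun e => ((U e : Matrix.specialUnitaryGroup (Fin N) ℂ) : Matrix (Fin N) (Fin N) ℂ)) (slabTwistPhase k))) 0
          (a - 0) (a - 0)) ∘ sliceDir U T_V := by
    funext y
    simp only [Function.comp_apply, sub_zero, fderiv_chartAction_zero_sliceDir U T_V k hU, inner_sliceHessian, slicePhase, map_zero]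
  rw [h2]
  refine h1.trans_isBigO ?_
  -- `‖S y‖² = O(‖y‖²)`
  have hO : (fun y => ‖sliceDir U T_V y‖) =O[𝓝 0] fun y => ‖y‖ := ((sliceDir U T_V).isBigO_id (𝓝 0)).norm_norm
  have hO2 := hO.pow 2
  refine (IsBigO.of_bound 1 (Eventually.of_forall fun y => ?_)).trans hO2
  rw [Function.comp_apply, sub_zero, one_mul]

end Taylor

end Summit.QuantumFields.YangMills.Cruxes.IRcof.TwistedSlab

end
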